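import Literature.Computability.AlgebraicComplexity.MS2001KempfStabilityHolds
import Literature.Computability.AlgebraicComplexity.MS2001FormESymmetries
import Literature.Computability.AlgebraicComplexity.MS2001FormEStabilizerIrreducible
import Literature.Computability.AlgebraicComplexity.MS2001FormERowOne
import HarnessLib

/-!
# GCT I, Thm. 7.3 over every algebraically closed field: `E(X)` is stable — the closer
# (Mulmuley–Sohoni 2001, Thm. 7.3; discharge of the typed fact `MS2001_thm_7_3`)

ROUTE (cell val-lit, lead-bip ruling #70-bis (B), «Route B»): the stabiliser of `E(X)` in
`SL(X)` — which contains the column torus `{∏ t = 1}` (`MS2001FormE.linSubst_diagonal_snd_msE`),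
`SL_m` on the rows (`MS2001FormE.linSubst_kronecker_one_msE_of_det`) and the sign-`+1`
relabellings (`MS2001FormE.linSubst_relabel_permMatrix_msE_of_sign_eq`) — acts IRREDUCIBLY on
`X = F^{m × mk}` (`MS2001FormEStabilizerIrreducible.lean`), so by Kempf's criterion
(`isPolystable_of_forall_submodule`, Kempf 1978 Cor. 4.5, `MS2001KempfStabilityHolds.lean`) the
`SL`-orbit of `E(X)` is closed, exactly as for `det_m` / `per_n` (GCT I Thms. 4.6, 4.7). The corner
`(m, k) = (1, 2)` (`E = x y`, stabiliser a torus, module reducible) is the closed orbit of the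
non-degenerate binary quadratic form. MS's own §8 argument (weighted flag, `Y = E ⊕ F ⊕ H`,
eqs. (14)–(19); its first half is `MS2001FormEWreathModule.lean`) is thereby not needed: the
sentence «`D'` is actually contained in a suitable parabolic subgroup» (AV p.35) concerns the
finite group `D'` alone, not the full stabiliser with its torus.

CONTENTS: the binder bookkeeping (`two_le_of_not_ringChar_dvd`, `one_le_of_not_ringChar_dvd`,
`ringChar_ne_two_of_not_dvd`), the GLUE theorem `MS2001_thm_7_3_of_stabilizer_irreducible` (the
fact from two inputs: stabiliser irreducibility for `(2 ≤ m ∧ 2 ≤ k) ∨ (m = 1 ∧ 3 ≤ k)`, and the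
corner `(1, 2)`), and the DISCHARGE **`MS2001_thm_7_3_holds : MS2001_thm_7_3`**, feeding the glue
with `MS2001_msEStabilizer_irreducible` (p5 g6, `MS2001FormEStabilizerIrreducible.lean`:
`2 ≤ m ∨ 3 ≤ k`, every infinite field) and `isPolystable_msE_one` (t14 g7,
`MS2001FormERowOne.lean`: `E(X)` for `m = 1` is the product of the `k` variables, polystable for
every `k` over every algebraically closed field), and the hypothesis-free corollary
`isPolystable_msE (m kk) : IsPolystable (msE K m kk)` (all `m`, `k`; p5 g6's offer). HONEST SCOPE: Route B uses none of MS's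
divisibility provisos beyond `k ≥ 2`, `m ≥ 1` (which they force in every characteristic) — the
inputs prove MORE (all `m`, `k`, every algebraically closed field); the fact is discharged exactly
as typed. Nothing here bears on VP versus VNP.

## References

* [MulmuleySohoniSIAM2001] K. D. Mulmuley, M. Sohoni, *Geometric complexity theory I*, SIAM J.
  Comput. 31 (2001) 496–526; authors' version Thm. 7.3 (AV p.31, all.txt L2342–2347), §8.
* [Kempf1978] G. R. Kempf, *Instability in invariant theory*, Ann. of Math. 108 (1978), Cor. 4.4,
  Cor. 4.5.

## Provenance

Cell `val-lit`, seat `val-lit-t02` generation 8 (closer; inputs by p5 g6 — symmetries and stabiliser irreducibility —, t14 g7 — Kempf's criterion in consumable form and the row-one corner —, t01 g6 — the irreducibility template and review; route proposed by p5 g6, lead-bip ruling #70-bis (B)).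
-/

noncomputable section

open MvPolynomial

namespace Literature.Computability.AlgebraicComplexity

section Binders

variable {F : Type*} [Field F]

/-- The divisibility provisos of GCT I Thm. 7.3 force `k ≥ 2`: `char F ∤ k` and `char F ∤ k − 1`
exclude `k = 0` and `k = 1` (as `char F ∣ 0`). [cite: MulmuleySohoniSIAM2001, Thm. 7.3 (AV p.31, all.txt L2342–2347)] -/
theorem two_le_of_not_ringChar_dvd {kk : ℕ} (h0 : ¬ ringChar F ∣ kk) (h1 : ¬ ringChar F ∣ (kk - 1)) :
    2 ≤ kk := by
  by_contra h
  rcases Nat.lt_succ_iff.mp (Nat.lt_of_not_le h) with _ | h'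
  · exact h1 (by simp)
  · have hk : kk = 0 := Nat.le_zero.mp h'
    exact h0 (by rw [hk]; exact dvd_zero _)

/-- The proviso `char F ∤ m` forces `m ≥ 1`. [cite: MulmuleySohoniSIAM2001, Thm. 7.3 (AV p.31, all.txt L2342–2347)] -/
theorem one_le_of_not_ringChar_dvd {m : ℕ} (h : ¬ ringChar F ∣ m) : 1 ≤ m := by
  rcases Nat.eq_zero_or_pos m with hm | hm
  · exact (h (by rw [hm]; exact dvd_zero _)).elim
  · exact hm

/-- The proviso `char F ∤ k` at `k = 2` says `char F ≠ 2`. [cite: MulmuleySohoniSIAM2001, Thm. 7.3 (AV p.31, all.txt L2342–2347)] -/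
theorem ringChar_ne_two_of_not_dvd (h : ¬ ringChar F ∣ 2) : ringChar F ≠ 2 :=
  fun h2 => h (by rw [h2])

end Binders

section Glue

/-- **GCT I Thm. 7.3 reduced to stabiliser irreducibility (Route B glue).** If, over every
algebraically closed field and for `(2 ≤ m ∧ 2 ≤ k) ∨ (m = 1 ∧ 3 ≤ k)`, no non-zero proper
subspace of `F^{m × mk}` is mapped into itself by every element of `SL ∩ Stab(E(X))` (the
stabiliser acts irreducibly — `MS2001FormEStabilizerIrreducible.lean`), and if the corner form
`E(X) = x·y` (`m = 1`, `k = 2`) is polystable whenever `char F ≠ 2`, then the typed fact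
`MS2001_thm_7_3` holds: Kempf's criterion `isPolystable_of_forall_submodule` (Kempf 1978,
Cor. 4.5) applied to the form `E(X)` of degree `m·k^m` (`MS2001FormE.msE_isHomogeneous`), after
the bookkeeping `char ∤ k, k − 1, m ⇒ k ≥ 2, m ≥ 1`. (Same architecture as
`MS2001_thm_4_6_of_parabolic` / `MS2001_thm_4_6_holds` for `det_m`.)
[cite: MulmuleySohoniSIAM2001, Thm. 7.3 (AV p.31, all.txt L2342–2347); §8 (AV p.35, «Kempf's criteria»)]
[cite: Kempf1978, Cor. 4.5] -/
theorem MS2001_thm_7_3_of_stabilizer_irreducible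
    (hirr : ∀ (F : Type) [Field F] [IsAlgClosed F] (m kk : ℕ),
      (2 ≤ m ∧ 2 ≤ kk) ∨ (m = 1 ∧ 3 ≤ kk) →
      ∀ W : Submodule F (Fin m × (Fin m × Fin kk) → F),
        (∀ γ ∈ slSubgroup (Fin m × (Fin m × Fin kk)) F ⊓ linStabilizer (msE F m kk), ∀ w ∈ W,
          (γ : Matrix (Fin m × (Fin m × Fin kk)) (Fin m × (Fin m × Fin kk)) F).mulVec w ∈ W) →
        W = ⊥ ∨ W = ⊤)
    (h12 : ∀ (F : Type) [Field F] [IsAlgClosed F], ringChar F ≠ 2 → IsPolystable (msE F 1 2)) :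
    MS2001_thm_7_3 := by
  intro F _ _ m kk hk hk1 hm
  have hkk : 2 ≤ kk := two_le_of_not_ringChar_dvd hk hk1
  have hm1 : 1 ≤ m := one_le_of_not_ringChar_dvd hm
  rcases Nat.lt_or_ge m 2 with hlt | hge
  · obtain rfl : m = 1 := by omega
    rcases Nat.lt_or_ge kk 3 with hk3 | hk3
    · obtain rfl : kk = 2 := by omega
      exact h12 F (ringChar_ne_two_of_not_dvd hk)
    · exact isPolystable_of_forall_submodule (MS2001FormE.msE_isHomogeneous (F := F) 1 kk)
        (hirr F 1 kk (Or.inr ⟨rfl, hk3⟩))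
  · exact isPolystable_of_forall_submodule (MS2001FormE.msE_isHomogeneous (F := F) m kk)
      (hirr F m kk (Or.inl ⟨hge, hkk⟩))

end Glue

section Discharge

/-- **Mulmuley–Sohoni 2001, Thm. 7.3, over every algebraically closed field** (discharge of the
typed fact `MS2001_thm_7_3`): «The point `E(X) ∈ P(W)` is stable with respect to the action of
`G = SL_n(F)` on `P(W)`. We assume that the characteristic does not divide `k`, `k − 1`, or `m`»
— the `SL_{km²}`-orbit of `E(X) = ∏_σ det_σ(X)` is Zariski closed. Proof (Route B of the cell, not
MS's §8 weighted-flag computation): the stabiliser of `E(X)` in `SL(X)` acts irreducibly on `X`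
(`MS2001_msEStabilizer_irreducible`: column torus, `SL_m` on the rows, sign-`+1` relabellings;
`2 ≤ m ∨ 3 ≤ k`), so Kempf's criterion (`isPolystable_of_forall_submodule`, Kempf 1978 Cor. 4.5)
closes the orbit, exactly as for `det_m`, `per_n` (Thms. 4.6, 4.7); for `m = 1`, `E(X)` is the
product of the `k` variables (`isPolystable_msE_one`). The provisos are used only through
`k ≥ 2`, `m ≥ 1`. [cite: MulmuleySohoniSIAM2001, Thm. 7.3 of the authors' version = journal Thm. 7.1 (inferred) (AV p.31, all.txt L2342–2347)]
[cite: Kempf1978, Cor. 4.5] -/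
theorem MS2001_thm_7_3_holds : MS2001_thm_7_3 :=
  MS2001_thm_7_3_of_stabilizer_irreducible
    (fun F _ _ _ _ h W hW => MS2001_msEStabilizer_irreducible (K := F)
      (h.elim (fun h => Or.inl h.1) fun h => Or.inr h.2) W hW)
    (fun F _ _ _ => isPolystable_msE_one (K := F) 2)

/-- **`E(X)` is polystable for EVERY `m`, `k` over every algebraically closed field** — the
hypothesis-free strengthening of GCT I Thm. 7.3 that Route B actually proves (no divisibility
provisos): `m ≥ 2` by `MS2001_msEStabilizer_irreducible` + Kempf, `m = 1` by `isPolystable_msE_one`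
(product of the variables), `m = 0` trivially (no variables: every subspace of `K^∅` is `⊥`).
Offered compile-checked by p5 g6 (bip/p5g6-OFFER-isPolystable_msE-allmk.lean.txt); recorded here so
that consumers need not thread the provisos. (MS state the result only under «the characteristic
does not divide `k`, `k − 1`, or `m`»; this is stronger.)
[cite: MulmuleySohoniSIAM2001, Thm. 7.3 (AV p.31, all.txt L2342–2347)] [cite: Kempf1978, Cor. 4.5] -/
theorem isPolystable_msE {K : Type} [Field K] [IsAlgClosed K] (m kk : ℕ) :
    IsPolystable (msE K m kk) := by
  rcases Nat.lt_or_ge m 2 with hm | hm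
  · interval_cases m
    · exact isPolystable_of_forall_submodule (MS2001FormE.msE_isHomogeneous (F := K) 0 kk)
        fun W _ => Or.inl (Subsingleton.elim _ _)
    · exact isPolystable_msE_one kk
  · exact isPolystable_of_forall_submodule (MS2001FormE.msE_isHomogeneous (F := K) m kk)
      fun W hW => MS2001_msEStabilizer_irreducible (Or.inl hm) W hW

end Discharge

end Literature.Computability.AlgebraicComplexity
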